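import Summits.QuantumFields.YangMills.Theorems.UnitScaleTiltProp7LaplaceAFlatLetters
import Summits.QuantumFields.YangMills.Theorems.UnitScaleTiltProp7SectET3GaugeProjectorT3Rows
import Summits.QuantumFields.YangMills.Theorems.UnitScaleTiltProp7FlatProjectorSeam
import Summits.QuantumFields.YangMills.Theorems.UnitScaleTiltProp7FlatCoercivityR
import Summits.QuantumFields.YangMills.Theorems.UnitScaleTiltProp7HessOnPrintSlice
import Summits.QuantumFields.YangMills.Theorems.UnitScaleTiltProp7QkOntoOfRegPr
import HarnessLib

/-!
# Route `UnitScaleTilt`, crux K1 «MinimiserStabilityRegPr» (stmt-QuantumFields-19200) — ★★OWNER RULING g28-№13 (c3) + 02:02:11Z (c3′), FILE B, THE KNIT: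
# **AT THE TRIVIAL BACKGROUND, BRICK L0d's `Δ_a(1) = Δ^η(1) + D R_S(1) D* + Q*aQ` IS COERCIVE WITH [Balaban1984PropagatorsI] PROP. 1.1's `k`-∕VOLUME-FREE CONSTANT `1∕(4·Cst 3 a₀)`,
# AT THE MEMBER-SCALED WEIGHT `a := a₀·(c₀∕cB)·(L^(K−n))^3`, AND ITS INVERSE `G(1)` IS BOUNDED BY `4·Cst 3 a₀`**

Cell `ym3-torus`, width seat `ym3-torus-px6` g5 (LOCATE «(c3) A6-FLAT GUARD» 75393a2303e20e25 = 19200 evidence #58; ★★OWNER ACK 91 «px6 g5 owns the (c3) certificate»; ★p1 g17 WORD 10 (2)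
«A6-FLAT GO»; ★★OWNER 02:02:11Z (c3′) «flat certificate ‖G₀(1)‖ ≤ 4·Cst 3 a′ ⟸ ✓flat_coercive_R_T3 through px6's seams»).  THEOREMS ONLY (0 `def`, 0 `sorry`);
`--supports stmt-QuantumFields-19200 --as helper`; count-neutral.  YM₃ on T³ is ladder rung R3, NOT d = 4, NOT the Clay problem; nothing here claims the stub, the crux, HESS, `hcoW`,
a curved-background coercivity or the mass gap.

WHY.  RULING g28-№13 displays ONE analytic input for the (A′) architecture, a coercivity row «`γ(L)·‖y‖² ≤ re⟪y, Δ_a(W) y⟫`» for brick L0d's `laplaceA` (or, after 02:02:11Z, the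
sibling inverse bound `norm_G₀`), on condition that its flat instance `W = 1` be a THEOREM by name from ✓`Prop7FlatCoercivityR.flat_coercive_R_T3`.  This file is that certificate.
INGREDIENTS (all in the tree): FILE A ✓`Prop7LaplaceAFlatLetters` (the flat letters `re⟪·, Δ^η(1)·⟫ = c₀η⁻²Σ|curl₁|²`, `‖Q_k(1)·‖² = cB·Σ|Q_{K−n}|²` — NO power of η —, `‖·‖² = c₀Σ|·|²`, entrywise in
the 8 real components), px4 g5's projector seam ✓`Prop7FlatProjectorSeam.mul_sum_norm_sq_RE_dsE_entries_le_norm_sq_RS_one_DstarL2` (S4: `c₀·Σ_e ‖R_flat ∂*x_e‖² ≤ ‖R_S(1)D*(1)y‖²`, one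
Cauchy–Schwarz on the range `Δ^η(1)N_S(1) ⊇ Δ N(Q′)` via flat (3.115)), and ✓`flat_coercive_R_T3` on each of the 8 real components.  The weight: against the flat theorem's penalty
`a₀·(L^{K−n})³·Σ(Q x)²` the member's `a·‖Q_k(1)y‖² = a·cB·Σ|Q x|²` matches iff `a·cB = a₀·c₀·L^{3(K−n)}` — the LOCATE's (V1)∕(V2), now namer rule (★p1 g17 WORD 10): in the display's
L-only weights `c₀ cB` the `Q*aQ` weight MUST be `a := a₀·(c₀∕cB)·(L^(K−n))^3` (print's `c₀ = η³, cB = 1, a = a₀`); with an L-only `a` the row fails at `U₀ = 1` on constant fields.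

WHAT IS PROVED (ns `…Theorems.Prop7LaplaceAFlatCoercive`; member `F n K`, `h : n ≤ K`, weights `c₀ cB > 0`).
* §4 ★★`re_inner_laplaceA` — ANY background: `re⟪y, laplaceA … a Δx U₀ y⟫ = re⟪y, Δx U₀ y⟫ + ‖R_S(U₀)(D*_{U₀} y)‖² + a·‖Q_k(U₀) y‖²` (✓`laplaceA_eq_laplaceAK`, ✓`adjoint_DL2`,
  ✓`RS_isSymmetric`∕`RS_RS`; member-letter twin of ★p1's `Prop7CoerciveSlotsOfInverseBound.re_inner_laplaceAK_eq`);
  ★★★**`coercive_laplaceA_one`**: for `a₀ > 0` and ANY slot `Δx` with `Δx 1 = DeltaEta F n K c₀ 1`: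
  `(1∕(4·Cst 3 a₀))·‖y‖² ≤ re⟪y, laplaceA F n K h c₀ cB (a₀·(c₀∕cB)·((F.L:ℝ)^(K−n))^3) Δx 1 y⟫` for ALL `y`.
* §5 ★★★`coercive_laplaceA_one_etaSlot_add_TJ` (the `hPosΔ`∕(COERC) slot `DeltaEtaSlot + TJSlotP a′`, any `a′`, by FILE A's `TJSlotP_one`), `coercive_laplaceA_one_etaSlot` (`Δ^η` alone = `G₀`'s slot);
  ★`posOnto_one` (`n < K`: `Δ_a(1)` positive definite from the coercivity, `Q_k(1)` onto from ✓`surjective_Qk_of_regPr` ∘ lit ✓`regPr_one` — so `GT … 1` IS print's `G(1)`);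
  ★★★**`norm_GT_one_le`** — the (c3′) flat inverse bound: `‖GT F n K _ c₀ cB (a₀·(c₀∕cB)·(L^(K−n))^3) Δx 1 f‖ ≤ 4·Cst 3 a₀·‖f‖` (coercivity ∘ ✓`laplaceA_GT` ∘ Cauchy–Schwarz).
HONEST SCOPE.  `U₀ = 1` only; the curved rows (Thm 3.11 ∕ Thm 3.3 class, N06) are NOT touched; no claim on any stub ∕ crux ∕ summit statement.

References: T. Bałaban, CMP **95** (1984) 17–40 [Balaban1984PropagatorsI] (Prop. 1.1 (1.89)–(1.90) p.33, (1.69)–(1.72) pp.29–30); CMP **99** (1985) 389–434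
[Balaban1985BackgroundPropagators] ((3.8)–(3.11) p.392, (3.19) p.393, (3.21)–(3.27) pp.394–395, Thm 3.4 p.400, Thm 3.11 p.416, (3.127)–(3.128) p.421); CMP **102** (1985) 277–309
[Balaban1985Variational] ((110) p.294, (141)–(142) p.299).
-/

set_option autoImplicit false

noncomputable section

open scoped InnerProductSpace ComplexConjugate Matrix.Norms.L2Operator BigOperators
open Complex (I)

namespace Summit.QuantumFields.YangMills.Theorems.Prop7LaplaceAFlatCoercive

open Literature.MathematicalPhysics.QuantumFieldTheory.Balaban1983to89
open Literature.MathematicalPhysics.QuantumFieldTheory.Balaban1983to89.T3ContinuumYM3Torus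
open T3SectALandauChart (formComp bgUnits bgUnits_one eta eta_pos)
open LatticeFieldCalculus (curl diverg grad laplace bondAvgIter siteAvgIter)
open B9SectCLatticeCarrier (Bond)
open B9TorusCalculus (torusT)
open B9Eq311L2Pairing (WL2)
open B11Eq103H1Complex (SiteL2K BondL2K projR)
open B6SectADomainsV1 B6SectAOperatorsV1 B6SectCTwoScaleV1
open Literature.MathematicalPhysics.QuantumFieldTheory.BalabanImbrieJaffe1984to88.BIJ85AxialPropagator411 (BondSpace)
open Summit.QuantumFields.YangMills.Theorems.Prop7SectET3Transport (periodsT3 siteEquiv bondEquiv bgOfCfg)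
open Summit.QuantumFields.YangMills.Theorems.Prop7SectET3HilbertLetters (W₂ frobEquiv toL2 toL2S toL2B QL2 DL2 DstarL2 covLapSite inner_toL2 inner_toL2B adjoint_DL2)
open Summit.QuantumFields.YangMills.Theorems.Prop7SectET3GaugeProjector (QDS NS RS RS_eq_projR RS_isSymmetric RS_RS)
open Summit.QuantumFields.YangMills.Theorems.Prop7SectET3WilsonHessian (DeltaEta DeltaEtaSlot)
open Summit.QuantumFields.YangMills.Theorems.Prop7SectET3DeltaOnePInv (TJSlotP DeltaOnePJ DeltaOnePJ_apply_eq_DeltaPiSlotP_of_actionGrad_eq_zero)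
open Summit.QuantumFields.YangMills.Theorems.Prop7SectET3DeltaPiPInv (gaugeCorrP DeltaPiP DeltaPiSlotP gaugeCorrP_apply DeltaPiP_apply)
open Summit.QuantumFields.YangMills.Theorems.Prop7SectET3WilsonHessian (DeltaEta_isSymmetric)
open Summit.QuantumFields.YangMills.Theorems.Prop7SectET3CurvedPropagators (Qk laplaceA PosOnto GT laplaceA_GT)
open Summit.QuantumFields.YangMills.Theorems.Prop7LandauDict (bondEquiv_symm_unshift bondEquiv_symm_siteEquiv)
open Summit.QuantumFields.YangMills.Theorems.Prop7SectET3RealCoordSums (inner_toL2S)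
open Summit.QuantumFields.YangMills.Theorems.Prop7SectET3DeltaEtaExplicit (DeltaEta_toL2_eq)
open Summit.QuantumFields.YangMills.Theorems.Prop7LaplaceAFlatLetters

variable {F : T3Family} {n K : ℕ} {c₀ : ℝ}

/-! ## §4 The knit: `Δ_a(1)` is coercive with print's constant, at the member-scaled weight `a := a₀·(c₀∕cB)·(L^(K−n))^3` -/

section Knit

variable [Fact (0 < c₀)]

/-- ★★ **THE FORM OF `Δ_a(U₀)` AS THREE TERMS** (any background): `re⟨y, Δ_a(U₀)y⟩ = re⟨y, Δx(U₀)y⟩ + ‖R_S(U₀)(D*_{U₀}y)‖² + a·‖Q_k(U₀)y‖²` — brick L0d's `laplaceA` is lit's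
`laplaceAK` (✓`laplaceA_eq_laplaceAK`), `D*` is the adjoint of `D` (✓`adjoint_DL2`), `R_S` is an orthogonal projection (✓`RS_isSymmetric`, ✓`RS_RS`).
[cite: Balaban1985BackgroundPropagators, (3.26) p.395, (3.21) p.394, (3.8) p.392; Balaban1985Variational, (110) p.294] -/
theorem re_inner_laplaceA {h : n ≤ K} {cB : ℝ} [Fact (0 < cB)] (a : ℝ)
    (Δx : GaugeField (F.P K) 0 (Matrix.specialUnitaryGroup (Fin 2) ℂ) → (BondL2K ℂ 3 (periodsT3 F K) c₀ W₂ →ₗ[ℂ] BondL2K ℂ 3 (periodsT3 F K) c₀ W₂))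
    (U₀ : GaugeField (F.P K) 0 (Matrix.specialUnitaryGroup (Fin 2) ℂ)) (y : BondL2K ℂ 3 (periodsT3 F K) c₀ W₂) :
    RCLike.re ⟪y, laplaceA F n K h c₀ cB a Δx U₀ y⟫_ℂ
      = RCLike.re ⟪y, Δx U₀ y⟫_ℂ + ‖RS F n K h c₀ cB U₀ (DstarL2 F n K c₀ U₀ y)‖ ^ 2 + a * ‖Qk F n K h c₀ cB U₀ y‖ ^ 2 := by
  rw [Prop7HessOnPrintSlice.laplaceA_eq_laplaceAK, B11Eq103H1Complex.laplaceAK_apply, inner_add_right, inner_add_right, map_add, map_add]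
  congr 1
  · congr 1
    -- the gauge penalty: `⟨y, D R D* y⟩ = ⟨D*y, R D*y⟩ = ‖R D*y‖²`
    rw [← LinearMap.adjoint_inner_left, adjoint_DL2]
    set u := DstarL2 F n K c₀ U₀ y
    have key : ⟪u, RS F n K h c₀ cB U₀ u⟫_ℂ = ⟪RS F n K h c₀ cB U₀ u, RS F n K h c₀ cB U₀ u⟫_ℂ := by
      rw [RS_isSymmetric U₀ u (RS F n K h c₀ cB U₀ u), RS_RS]
    rw [key]
    exact (norm_sq_eq_re_inner _).symm
  · -- the averaging penalty: `⟨y, Q†(a·Qy)⟩ = a‖Qy‖²`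
    rw [LinearMap.adjoint_inner_right, inner_smul_right, norm_sq_eq_re_inner (𝕜 := ℂ) (Qk F n K h c₀ cB U₀ y)]
    simp only [RCLike.re_to_complex, Complex.re_ofReal_mul]

/-- ★★★ **(c3) OF ★★OWNER RULING g28-№13, THE FLAT CERTIFICATE: `Δ_a(1)` IS COERCIVE WITH PRINT'S `k`-∕VOLUME-FREE CONSTANT AT THE MEMBER-SCALED WEIGHT** — for every `a₀ > 0` and every Hessian
slot `Δx` whose value at the trivial background is brick L0b's `Δ^η(1)` (`DeltaEtaSlot`, `DeltaEtaSlot + TJSlotP` by FILE A's `TJSlotP_one`):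
`(1∕(4·Cst 3 a₀))·‖y‖² ≤ re⟨y, laplaceA F n K h c₀ cB (a₀·(c₀∕cB)·(L^(K−n))^3) Δx 1 y⟩` for ALL `y` — ✓`flat_coercive_R_T3` ([Balaban1984PropagatorsI] (1.90) with print's `R`) on the 8
real components, FILE A's flat letters, and px4 g5's projector seam ✓`Prop7FlatProjectorSeam.mul_sum_norm_sq_RE_dsE_entries_le_norm_sq_RS_one_DstarL2`.  The weight `a₀·(c₀∕cB)·η⁻³` is print's `c₀ = η³, cB = 1, a = a₀` in the display's L-only
weights (LOCATE (V2), namer rule ★p1 g17 WORD 10): with an L-only `a` the row is false for `K − n` large (constant field). [cite: Balaban1984PropagatorsI, Prop. 1.1 (1.89)–(1.90) p.33; Balaban1985BackgroundPropagators, Thm 3.11 p.416, (3.26) p.395; Balaban1985Variational, (110) p.294, (141)–(142) p.299] -/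
theorem coercive_laplaceA_one {h : n ≤ K} {cB : ℝ} [Fact (0 < cB)] {a₀ : ℝ} (ha₀ : 0 < a₀)
    (Δx : GaugeField (F.P K) 0 (Matrix.specialUnitaryGroup (Fin 2) ℂ) → (BondL2K ℂ 3 (periodsT3 F K) c₀ W₂ →ₗ[ℂ] BondL2K ℂ 3 (periodsT3 F K) c₀ W₂))
    (hΔ : Δx 1 = (DeltaEta F n K c₀ 1 : BondL2K ℂ 3 (periodsT3 F K) c₀ W₂ →ₗ[ℂ] BondL2K ℂ 3 (periodsT3 F K) c₀ W₂))
    (y : BondL2K ℂ 3 (periodsT3 F K) c₀ W₂) :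
    (1 / (4 * B5Prop11Plancherel.Cst 3 a₀)) * ‖y‖ ^ 2
      ≤ RCLike.re ⟪y, laplaceA F n K h c₀ cB (a₀ * (c₀ / cB) * ((F.L : ℝ) ^ (K - n)) ^ 3) Δx (1 : GaugeField (F.P K) 0 (Matrix.specialUnitaryGroup (Fin 2) ℂ)) y⟫_ℂ := by
  obtain ⟨X, rfl⟩ := (toL2 F K c₀).surjective y
  have hc₀ : 0 < c₀ := Fact.out
  have hcB : 0 < cB := Fact.out
  set s : ℝ := (F.L : ℝ) ^ (K - n) with hs
  set γ : ℝ := 1 / (4 * B5Prop11Plancherel.Cst 3 a₀) with hγ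
  have hη : (eta F n K)⁻¹ = s := by rw [eta, inv_pow, inv_inv]
  -- the three terms of `Δ_a(1)` at the flat letters
  rw [re_inner_laplaceA, LinearMap.congr_fun hΔ (toL2 F K c₀ X), ContinuousLinearMap.coe_coe, re_inner_DeltaEta_one_re_im, norm_sq_Qk_one_re_im,
    norm_sq_toL2_re_im, hη]
  -- ✓`flat_coercive_R_T3` on one real component
  have hcomp : ∀ Y : VecField (F.P K) 0 ℝ,
      γ * ∑ b, Y b ^ 2 ≤ s ^ 2 * ∑ p, curl 1 Y p ^ 2
        + ‖RE (twoScale (K - n) (Prop7FlatCoercivityR.succ_le_T3 F n K) (∅ : Finset (Site (F.P K) (K - n + 1)))) s (dsE s (WithLp.toLp 2 Y))‖ ^ 2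
        + a₀ * s ^ 3 * ∑ c, bondAvgIter (K - n) Y c ^ 2 := by
    intro Y
    have hh := Prop7FlatCoercivityR.flat_coercive_R_T3 F n K ha₀ (WithLp.toLp 2 Y)
    have hcurl : ∀ p : Plaq (F.P K) 0, curl s Y p = s * curl 1 Y p := fun p => by
      simp only [LatticeFieldCalculus.curl, smul_eq_mul, one_mul]
    simp only [← hs, hcurl, mul_pow, ← Finset.mul_sum] at hh
    norm_num at hh
    rw [hγ, show (1 / (4 * B5Prop11Plancherel.Cst 3 a₀)) = (B5Prop11Plancherel.Cst 3 a₀)⁻¹ * (1 / 4) by ring]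
    exact hh
  -- the 8 components, summed
  have hsum : γ * ∑ i : Fin 2, ∑ i' : Fin 2, (∑ b, (X b i i').re ^ 2 + ∑ b, (X b i i').im ^ 2)
      ≤ s ^ 2 * ∑ i : Fin 2, ∑ i' : Fin 2, (∑ p, curl 1 (fun b => (X b i i').re) p ^ 2 + ∑ p, curl 1 (fun b => (X b i i').im) p ^ 2)
        + ∑ i : Fin 2, ∑ i' : Fin 2,
            (‖RE (twoScale (K - n) (Prop7FlatCoercivityR.succ_le_T3 F n K) (∅ : Finset (Site (F.P K) (K - n + 1)))) s (dsE s (WithLp.toLp 2 fun b => (X b i i').re))‖ ^ 2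
              + ‖RE (twoScale (K - n) (Prop7FlatCoercivityR.succ_le_T3 F n K) (∅ : Finset (Site (F.P K) (K - n + 1)))) s (dsE s (WithLp.toLp 2 fun b => (X b i i').im))‖ ^ 2)
        + a₀ * s ^ 3 * ∑ i : Fin 2, ∑ i' : Fin 2, (∑ c, bondAvgIter (K - n) (fun b => (X b i i').re) c ^ 2 + ∑ c, bondAvgIter (K - n) (fun b => (X b i i').im) c ^ 2) := by
    rw [Finset.mul_sum, Finset.mul_sum, Finset.mul_sum, ← Finset.sum_add_distrib, ← Finset.sum_add_distrib]
    refine Finset.sum_le_sum fun i _ => ?_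
    rw [Finset.mul_sum, Finset.mul_sum, Finset.mul_sum, ← Finset.sum_add_distrib, ← Finset.sum_add_distrib]
    refine Finset.sum_le_sum fun i' _ => ?_
    have h1 := hcomp (fun b => (X b i i').re)
    have h2 := hcomp (fun b => (X b i i').im)
    calc γ * (∑ b, (X b i i').re ^ 2 + ∑ b, (X b i i').im ^ 2)
        = γ * ∑ b, (X b i i').re ^ 2 + γ * ∑ b, (X b i i').im ^ 2 := by ring
      _ ≤ _ := add_le_add h1 h2
      _ = _ := by ring
  -- the projector seam and the weight bookkeeping `a·cB = a₀·c₀·s³`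
  have hR := Prop7FlatProjectorSeam.mul_sum_norm_sq_RE_dsE_entries_le_norm_sq_RS_one_DstarL2 F n K h c₀ cB X
  calc γ * (c₀ * ∑ i : Fin 2, ∑ i' : Fin 2, (∑ b, (X b i i').re ^ 2 + ∑ b, (X b i i').im ^ 2))
      = c₀ * (γ * ∑ i : Fin 2, ∑ i' : Fin 2, (∑ b, (X b i i').re ^ 2 + ∑ b, (X b i i').im ^ 2)) := by ring
    _ ≤ c₀ * (s ^ 2 * ∑ i : Fin 2, ∑ i' : Fin 2, (∑ p, curl 1 (fun b => (X b i i').re) p ^ 2 + ∑ p, curl 1 (fun b => (X b i i').im) p ^ 2)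
        + ∑ i : Fin 2, ∑ i' : Fin 2,
            (‖RE (twoScale (K - n) (Prop7FlatCoercivityR.succ_le_T3 F n K) (∅ : Finset (Site (F.P K) (K - n + 1)))) s (dsE s (WithLp.toLp 2 fun b => (X b i i').re))‖ ^ 2
              + ‖RE (twoScale (K - n) (Prop7FlatCoercivityR.succ_le_T3 F n K) (∅ : Finset (Site (F.P K) (K - n + 1)))) s (dsE s (WithLp.toLp 2 fun b => (X b i i').im))‖ ^ 2)
        + a₀ * s ^ 3 * ∑ i : Fin 2, ∑ i' : Fin 2, (∑ c, bondAvgIter (K - n) (fun b => (X b i i').re) c ^ 2 + ∑ c, bondAvgIter (K - n) (fun b => (X b i i').im) c ^ 2)) :=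
          mul_le_mul_of_nonneg_left hsum hc₀.le
    _ ≤ _ := by
          rw [mul_add, mul_add]
          refine add_le_add (add_le_add (le_of_eq (by ring)) hR) (le_of_eq ?_)
          field_simp

end Knit

/-! ## §5 Corollaries: the slots of record, `PosOnto` at the flat member, and the (c3′) inverse bound `‖G(1)‖ ≤ 4·Cst 3 a₀` -/

section Corollaries

variable [Fact (0 < c₀)]

/-- ★★★ **THE `hPosΔ`∕(COERC) SLOT `Δ^η + T_Jᴾ`**: for every `a₀ > 0` and any J-term weight `a′`,
`(1∕(4·Cst 3 a₀))·‖y‖² ≤ re⟨y, laplaceA … (a₀·(c₀∕cB)·(L^(K−n))^3) (DeltaEtaSlot + TJSlotP a′) 1 y⟩` (FILE A: `TJSlotP 1 = 0`).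
[cite: Balaban1984PropagatorsI, Prop. 1.1 (1.90) p.33; Balaban1985BackgroundPropagators, (3.127)–(3.128) p.421, Thm 3.11 p.416] -/
theorem coercive_laplaceA_one_etaSlot_add_TJ {h : n ≤ K} {cB : ℝ} [Fact (0 < cB)] {a₀ : ℝ} (ha₀ : 0 < a₀) (a' : ℝ)
    (y : BondL2K ℂ 3 (periodsT3 F K) c₀ W₂) :
    (1 / (4 * B5Prop11Plancherel.Cst 3 a₀)) * ‖y‖ ^ 2
      ≤ RCLike.re ⟪y, laplaceA F n K h c₀ cB (a₀ * (c₀ / cB) * ((F.L : ℝ) ^ (K - n)) ^ 3) (DeltaEtaSlot F n K c₀ + TJSlotP F n K h c₀ cB a')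
          (1 : GaugeField (F.P K) 0 (Matrix.specialUnitaryGroup (Fin 2) ℂ)) y⟫_ℂ :=
  coercive_laplaceA_one ha₀ _ deltaEtaSlot_add_TJSlotP_one y

/-- ★★ **THE `Δ^η` SLOT ALONE** (`G₀ = (Δ + DRD* + Q*aQ)⁻¹` of [B9] p.421 at `U₀ = 1`). [cite: Balaban1984PropagatorsI, Prop. 1.1 (1.90) p.33; Balaban1985BackgroundPropagators, (3.26)–(3.27) p.395, p.421] -/
theorem coercive_laplaceA_one_etaSlot {h : n ≤ K} {cB : ℝ} [Fact (0 < cB)] {a₀ : ℝ} (ha₀ : 0 < a₀) (y : BondL2K ℂ 3 (periodsT3 F K) c₀ W₂) :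
    (1 / (4 * B5Prop11Plancherel.Cst 3 a₀)) * ‖y‖ ^ 2
      ≤ RCLike.re ⟪y, laplaceA F n K h c₀ cB (a₀ * (c₀ / cB) * ((F.L : ℝ) ^ (K - n)) ^ 3) (DeltaEtaSlot F n K c₀)
          (1 : GaugeField (F.P K) 0 (Matrix.specialUnitaryGroup (Fin 2) ℂ)) y⟫_ℂ :=
  coercive_laplaceA_one ha₀ _ rfl y

/-- ★ **THE CLASS `PosOnto` AT THE FLAT MEMBER** (`n < K`): `Δ_a(1)` is positive definite (from the coercivity) and `Q_k(1)` is onto (✓`surjective_Qk_of_regPr` at the trivially regular `U₀ = 1`,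
✓`regPr_one`) — so brick L0d's total letters `GT`, `HT`, … ARE print's `G`, `H` at `U₀ = 1`. [cite: Balaban1985BackgroundPropagators, Thm 3.11 p.416, (3.19) p.393] -/
theorem posOnto_one (hnK : n < K) {cB : ℝ} [Fact (0 < cB)] {a₀ : ℝ} (ha₀ : 0 < a₀)
    (Δx : GaugeField (F.P K) 0 (Matrix.specialUnitaryGroup (Fin 2) ℂ) → (BondL2K ℂ 3 (periodsT3 F K) c₀ W₂ →ₗ[ℂ] BondL2K ℂ 3 (periodsT3 F K) c₀ W₂))
    (hΔ : Δx 1 = (DeltaEta F n K c₀ 1 : BondL2K ℂ 3 (periodsT3 F K) c₀ W₂ →ₗ[ℂ] BondL2K ℂ 3 (periodsT3 F K) c₀ W₂)) :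
    PosOnto F n K hnK.le c₀ cB (a₀ * (c₀ / cB) * ((F.L : ℝ) ^ (K - n)) ^ 3) Δx (1 : GaugeField (F.P K) 0 (Matrix.specialUnitaryGroup (Fin 2) ℂ)) := by
  have hL : (0 : ℝ) < F.L := by exact_mod_cast lt_trans zero_lt_one F.hL.2
  refine ⟨fun x hx => ?_, ?_⟩
  · have hγ : 0 < 1 / (4 * B5Prop11Plancherel.Cst 3 a₀) := by
      have := B5Prop11Lattice.Cst_pos (d := 3) (a := a₀)
      positivity
    exact lt_of_lt_of_le (mul_pos hγ (by positivity)) (coercive_laplaceA_one ha₀ Δx hΔ x)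
  · set ε₀ : ℝ := 1 / (13 * 10 ^ 14 * (F.L : ℝ) ^ 3) with hε₀
    have hε : 0 < ε₀ := by positivity
    have hwin : 13 * 10 ^ 14 * (F.L : ℝ) ^ 3 * ε₀ ≤ 1 := by
      rw [hε₀]; field_simp; exact le_rfl
    exact Prop7QkOntoOfRegPr.surjective_Qk_of_regPr F hnK.le hnK c₀ cB (T3PrintedRegularMinimiser.regPr_one (F := F) (n := n) (K := K) hε) hwin

/-- ★★★ **(c3′) OF ★★OWNER 02:02:11Z — THE FLAT INVERSE BOUND `‖G(1) f‖ ≤ 4·Cst 3 a₀·‖f‖`** for brick L0d's total letter `GT` at any slot that is `Δ^η(1)` at the flat member (`n < K`):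
coercivity `γ‖Gf‖² ≤ re⟨Gf, Δ_a Gf⟩ = re⟨Gf, f⟩ ≤ ‖Gf‖·‖f‖` (✓`laplaceA_GT` on the class `posOnto_one`). [cite: Balaban1985BackgroundPropagators, Thm 3.4 p.400, Thm 3.11 p.416, (3.27) p.395; Balaban1984PropagatorsI, Prop. 1.1 (1.89)–(1.90) p.33] -/
theorem norm_GT_one_le (hnK : n < K) {cB : ℝ} [Fact (0 < cB)] {a₀ : ℝ} (ha₀ : 0 < a₀)
    (Δx : GaugeField (F.P K) 0 (Matrix.specialUnitaryGroup (Fin 2) ℂ) → (BondL2K ℂ 3 (periodsT3 F K) c₀ W₂ →ₗ[ℂ] BondL2K ℂ 3 (periodsT3 F K) c₀ W₂))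
    (hΔ : Δx 1 = (DeltaEta F n K c₀ 1 : BondL2K ℂ 3 (periodsT3 F K) c₀ W₂ →ₗ[ℂ] BondL2K ℂ 3 (periodsT3 F K) c₀ W₂))
    (f : BondL2K ℂ 3 (periodsT3 F K) c₀ W₂) :
    ‖GT F n K hnK.le c₀ cB (a₀ * (c₀ / cB) * ((F.L : ℝ) ^ (K - n)) ^ 3) Δx (1 : GaugeField (F.P K) 0 (Matrix.specialUnitaryGroup (Fin 2) ℂ)) f‖
      ≤ 4 * B5Prop11Plancherel.Cst 3 a₀ * ‖f‖ := by
  have hp := posOnto_one (c₀ := c₀) hnK (cB := cB) ha₀ Δx hΔ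
  set g := GT F n K hnK.le c₀ cB (a₀ * (c₀ / cB) * ((F.L : ℝ) ^ (K - n)) ^ 3) Δx (1 : GaugeField (F.P K) 0 (Matrix.specialUnitaryGroup (Fin 2) ℂ)) f with hg
  have hC : 0 < B5Prop11Plancherel.Cst 3 a₀ := B5Prop11Lattice.Cst_pos (d := 3) (a := a₀)
  have h1 := coercive_laplaceA_one (h := hnK.le) (cB := cB) ha₀ Δx hΔ g
  rw [hg, laplaceA_GT hp f, ← hg] at h1
  have h2 : RCLike.re ⟪g, f⟫_ℂ ≤ ‖g‖ * ‖f‖ := re_inner_le_norm g f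
  have h3 : ‖g‖ ^ 2 ≤ 4 * B5Prop11Plancherel.Cst 3 a₀ * (‖g‖ * ‖f‖) := by
    have := h1.trans h2
    rw [div_mul_eq_mul_div, one_mul, div_le_iff₀ (by positivity)] at this
    linarith
  rcases (norm_nonneg g).eq_or_lt with h0 | hpos
  · rw [← h0]; positivity
  · nlinarith [norm_nonneg f]

end Corollaries

/-! ## §6 The two other displayed slots at the flat member: `Δ_πᴾ(1) = Δ^η(1) = Δ₁ᴾ(1)` (the gauge correction `Pᴾ` and the J-term are invisible at `U₀ = 1`) -/

section Slots

variable [Fact (0 < c₀)]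

/-- ★ **`Δ^η(1)` KILLS PURE GAUGES: `Δ^η(1)(D(1)λ) = 0`** — at the flat background `curl ∘ grad = 0` (lit ✓`LatticeFieldCalculus.curl_grad`), so `D¹*D¹(∂λ) = 0` and `Δ′ = 0`.
[cite: Balaban1985BackgroundPropagators, (3.10) p.392, (3.115) p.418; Balaban1984PropagatorsI, (1.4) p.18] -/
theorem DeltaEta_one_DL2_one (z : SiteL2K ℂ 3 (periodsT3 F K) c₀ W₂) :
    DeltaEta F n K c₀ (1 : GaugeField (F.P K) 0 (Matrix.specialUnitaryGroup (Fin 2) ℂ))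
      (DL2 F n K c₀ (1 : GaugeField (F.P K) 0 (Matrix.specialUnitaryGroup (Fin 2) ℂ)) z) = 0 := by
  obtain ⟨l, rfl⟩ := (toL2S F K c₀).surjective z
  have hD : DL2 F n K c₀ (1 : GaugeField (F.P K) 0 (Matrix.specialUnitaryGroup (Fin 2) ℂ)) (toL2S F K c₀ l) = toL2 F K c₀ (grad (eta F n K)⁻¹ l) := by
    rw [← Prop7FlatProjectorSeam.DL2_one_eq_grad F n K c₀ l, LinearEquiv.apply_symm_apply]
  rw [hD]
  set A : PBond (F.P K) 0 → Matrix (Fin 2) (Fin 2) ℂ := grad (eta F n K)⁻¹ l with hA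
  have hbg : (fun (μ : Fin (F.P K).d) (x : Site (F.P K) 0) => bgUnits F K (1 : GaugeField (F.P K) 0 (Matrix.specialUnitaryGroup (Fin 2) ℂ)) ⟨x, μ⟩)
      = fun (_ : Fin (F.P K).d) (_ : Site (F.P K) 0) => (1 : (Matrix (Fin 2) (Fin 2) ℂ)ˣ) := by
    funext μ x; rw [bgUnits_one]
  -- the [B9]-curl of a flat gradient vanishes in every orientation
  have hcurl : B9Eq39Adjoint.curl (torusT (F.P K) 0) (fun (_ : Fin (F.P K).d) (_ : Site (F.P K) 0) => (1 : (Matrix (Fin 2) (Fin 2) ℂ)ˣ)) (formComp A)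
      = fun _ _ _ => 0 := by
    funext μ ν x
    rcases lt_trichotomy μ ν with hlt | heq | hgt
    · rw [curl_torusT_one_formComp A hlt, hA, LatticeFieldCalculus.curl_grad]
    · subst heq; exact B9Eq39Adjoint.curl_self _ _ _ _ _
    · rw [B9Eq39Adjoint.curl_swap, curl_torusT_one_formComp A hgt, hA, LatticeFieldCalculus.curl_grad, neg_zero]
  have hdiv : ∀ μ x, B9Eq39Adjoint.divP (torusT (F.P K) 0) (fun (_ : Fin (F.P K).d) (_ : Site (F.P K) 0) => (1 : (Matrix (Fin 2) (Fin 2) ℂ)ˣ))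
      (fun (_ : Fin (F.P K).d) (_ : Fin (F.P K).d) (_ : Site (F.P K) 0) => (0 : Matrix (Fin 2) (Fin 2) ℂ)) μ x = 0 := fun μ x => by
    simp [B9Eq39Adjoint.divP, B9Eq39Adjoint.covDstar, B9Eq39Adjoint.R]
  rw [DeltaEta_toL2_eq, hbg]
  have hzero : (fun b : PBond (F.P K) 0 => ((((eta F n K)⁻¹ ^ 2 : ℝ) : ℂ)) •
      B9Eq310Hermitian.deltaOp (torusT (F.P K) 0) (fun (_ : Fin (F.P K).d) (_ : Site (F.P K) 0) => (1 : (Matrix (Fin 2) (Fin 2) ℂ)ˣ)) 1 (formComp A) b.dir b.src)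
      = 0 := by
    funext b
    rw [deltaOp_one, hcurl, hdiv, smul_zero, Pi.zero_apply]
  rw [hzero, map_zero]

/-- ★ **THE GAUGE CORRECTION IS INVISIBLE TO `Δ^η(1)`: `Δ^η(1) ∘ Pᴾ(1) = Δ^η(1)`** (`Pᴾ = 1 − D G′ᴾ R_S D*`, (3.119)). [cite: Balaban1985BackgroundPropagators, (3.119) p.419] -/
theorem DeltaEta_one_gaugeCorrP_one {h : n ≤ K} {cB a : ℝ} [Fact (0 < cB)] (y : BondL2K ℂ 3 (periodsT3 F K) c₀ W₂) :
    DeltaEta F n K c₀ (1 : GaugeField (F.P K) 0 (Matrix.specialUnitaryGroup (Fin 2) ℂ))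
        (gaugeCorrP F n K h c₀ cB a (1 : GaugeField (F.P K) 0 (Matrix.specialUnitaryGroup (Fin 2) ℂ)) y)
      = DeltaEta F n K c₀ (1 : GaugeField (F.P K) 0 (Matrix.specialUnitaryGroup (Fin 2) ℂ)) y := by
  rw [gaugeCorrP_apply, map_sub, DeltaEta_one_DL2_one, sub_zero]

/-- ★★ **`Δ_πᴾ(1) = Δ^η(1)`**: the `hPosπ` slot `DeltaPiSlotP` IS the Wilson Hessian at the flat member (`Pᴾᵀ Δ Pᴾ = Pᴾᵀ Δ = (Δ Pᴾ)ᵀ = Δ`, ✓`DeltaEta_isSymmetric`).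
[cite: Balaban1985BackgroundPropagators, (3.118)–(3.122) pp.419–420, (3.12) p.392] -/
theorem DeltaPiSlotP_one {h : n ≤ K} {cB a : ℝ} [Fact (0 < cB)] :
    DeltaPiSlotP F n K h c₀ cB a (1 : GaugeField (F.P K) 0 (Matrix.specialUnitaryGroup (Fin 2) ℂ))
      = (DeltaEta F n K c₀ (1 : GaugeField (F.P K) 0 (Matrix.specialUnitaryGroup (Fin 2) ℂ)) :
          BondL2K ℂ 3 (periodsT3 F K) c₀ W₂ →ₗ[ℂ] BondL2K ℂ 3 (periodsT3 F K) c₀ W₂) := by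
  apply LinearMap.ext
  intro y
  rw [Prop7SectET3DeltaPiPInv.DeltaPiSlotP_apply, DeltaPiP_apply, DeltaEta_one_gaugeCorrP_one]
  refine ext_inner_left ℂ fun w => ?_
  rw [LinearMap.adjoint_inner_right, ContinuousLinearMap.coe_coe]
  -- `⟪Pw, Δy⟫ = ⟪ΔPw, y⟫ = ⟪Δw, y⟫ = ⟪w, Δy⟫`
  have hsym : ∀ u v : BondL2K ℂ 3 (periodsT3 F K) c₀ W₂,
      ⟪DeltaEta F n K c₀ (1 : GaugeField (F.P K) 0 (Matrix.specialUnitaryGroup (Fin 2) ℂ)) u, v⟫_ℂ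
        = ⟪u, DeltaEta F n K c₀ (1 : GaugeField (F.P K) 0 (Matrix.specialUnitaryGroup (Fin 2) ℂ)) v⟫_ℂ := fun u v => by
    have := DeltaEta_isSymmetric (F := F) (n := n) (K := K) (c₀ := c₀) (1 : GaugeField (F.P K) 0 (Matrix.specialUnitaryGroup (Fin 2) ℂ)) u v
    simpa only [ContinuousLinearMap.coe_coe] using this
  rw [← hsym, DeltaEta_one_gaugeCorrP_one, hsym]

/-- ★★ **`Δ₁ᴾ(1) = Δ^η(1)`**: the `hPos₁` slot `DeltaOnePJ` too (the J-term vanishes at the critical flat background, FILE A's `actionGrad_one`, then `DeltaPiSlotP_one`).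
[cite: Balaban1985BackgroundPropagators, (3.127)–(3.130) p.421] -/
theorem DeltaOnePJ_one {h : n ≤ K} {cB a : ℝ} [Fact (0 < cB)] :
    DeltaOnePJ F n K h c₀ cB a (1 : GaugeField (F.P K) 0 (Matrix.specialUnitaryGroup (Fin 2) ℂ))
      = (DeltaEta F n K c₀ (1 : GaugeField (F.P K) 0 (Matrix.specialUnitaryGroup (Fin 2) ℂ)) :
          BondL2K ℂ 3 (periodsT3 F K) c₀ W₂ →ₗ[ℂ] BondL2K ℂ 3 (periodsT3 F K) c₀ W₂) := by
  apply LinearMap.ext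
  intro y
  rw [DeltaOnePJ_apply_eq_DeltaPiSlotP_of_actionGrad_eq_zero actionGrad_one, ← DeltaPiSlotP_one (h := h) (cB := cB) (a := a)]

/-- ★★★ **THE `hPosπ` SLOT**: `(1∕(4·Cst 3 a₀))·‖y‖² ≤ re⟨y, laplaceA … (a₀·(c₀∕cB)·(L^(K−n))^3) (DeltaPiSlotP …) 1 y⟩` — print's `G = (Δ_π + DRD* + Q*aQ)⁻¹` of (3.122) at the flat member.
[cite: Balaban1984PropagatorsI, Prop. 1.1 (1.90) p.33; Balaban1985BackgroundPropagators, (3.122) p.420, Thm 3.11 p.416] -/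
theorem coercive_laplaceA_one_piSlot {h : n ≤ K} {cB : ℝ} [Fact (0 < cB)] {a₀ : ℝ} (ha₀ : 0 < a₀) (a' : ℝ) (y : BondL2K ℂ 3 (periodsT3 F K) c₀ W₂) :
    (1 / (4 * B5Prop11Plancherel.Cst 3 a₀)) * ‖y‖ ^ 2
      ≤ RCLike.re ⟪y, laplaceA F n K h c₀ cB (a₀ * (c₀ / cB) * ((F.L : ℝ) ^ (K - n)) ^ 3) (DeltaPiSlotP F n K h c₀ cB a')
          (1 : GaugeField (F.P K) 0 (Matrix.specialUnitaryGroup (Fin 2) ℂ)) y⟫_ℂ :=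
  coercive_laplaceA_one ha₀ _ DeltaPiSlotP_one y

/-- ★★★ **THE `hPos₁` SLOT**: `(1∕(4·Cst 3 a₀))·‖y‖² ≤ re⟨y, laplaceA … (a₀·(c₀∕cB)·(L^(K−n))^3) (DeltaOnePJ …) 1 y⟩` — print's `G₁ = (Δ₁ + DRD* + aQ*Q)⁻¹` of [Balaban1985Variational] (110) at the
flat member. [cite: Balaban1984PropagatorsI, Prop. 1.1 (1.90) p.33; Balaban1985Variational, (110) p.294; Balaban1985BackgroundPropagators, (3.128) p.421] -/
theorem coercive_laplaceA_one_onePJSlot {h : n ≤ K} {cB : ℝ} [Fact (0 < cB)] {a₀ : ℝ} (ha₀ : 0 < a₀) (a' : ℝ) (y : BondL2K ℂ 3 (periodsT3 F K) c₀ W₂) :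
    (1 / (4 * B5Prop11Plancherel.Cst 3 a₀)) * ‖y‖ ^ 2
      ≤ RCLike.re ⟪y, laplaceA F n K h c₀ cB (a₀ * (c₀ / cB) * ((F.L : ℝ) ^ (K - n)) ^ 3) (DeltaOnePJ F n K h c₀ cB a')
          (1 : GaugeField (F.P K) 0 (Matrix.specialUnitaryGroup (Fin 2) ℂ)) y⟫_ℂ :=
  coercive_laplaceA_one ha₀ _ DeltaOnePJ_one y

end Slots

end Summit.QuantumFields.YangMills.Theorems.Prop7LaplaceAFlatCoercive

end
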